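import Summits.QuantumFields.YangMills.Theorems.OneCertifiedCubeContinuumLimitExistsUvBoundsOfArrayExponent
import Summits.QuantumFields.YangMills.Theorems.OneCertifiedCubeContinuumLimitExistsDefs

/-!
# `ContinuumLimitExists` (stmt-QuantumFields-16124), line `birth` v6: the E1 leg rides INSIDE the ∃-stub

Glue for the reshape v5 → v6 of the registered skeleton `Cruxes/ContinuumLimitExists/Lines/birth.lean`
(continuation lead `prover-line-stmt-QuantumFields-16124-c3-0`, cycle c3, 2026-08-17; reshape suggested and kernel-checked by
the c3 wave's `stub_rotation345` worker, `work/stubs/stub_rotation345_reshape_scratch.lean`).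

v1–v5 carried the E1 burden as a UNIVERSAL stub: `stub_rotation345 : ∀ r sch, weak → PVG → ConvProducts → UUVB → Rot345 r sch`
(O(4) restoration along EVERY weak-coupling, polynomially growing, product-convergent, UUVB Wilson sequence). Three waves (c1, c2,
c3: 218 Theorems/Theses files since 11:00Z, 47 with rotation vocabulary) found no producer, and — decisive for a thin line — NO
filed item or definition of the hub implies that ∀-form: every rotation statement in the tree is existential in the scheme, restricted
to tuned `M`-adic sequences (`UVEngine345` / `UVPhysics345`, 15828's child 2 `(UUVB) ∧ (ND) ∧ (ROT₃₄₅)`), or limit-side and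
gap-conditional (`CurvatureAmnesia`, stmt-16192). Since the crux is EXISTENTIAL and `Rot345` is a family of `Tendsto … atTop (𝓝 0)`
clauses — hence stable under sub-schemes exactly like `UUVB`, `ND2`, `ND3` (`rot345_subScheme`) — the one-rotation clause can be
carried by the constructed sequence itself:

  v6 ∃-stub `stub_uvBounds345 : ∀ G compact simple, ∃ r sch, weak ∧ PVG ∧ UUVB ∧ Rot345 ∧ ND2 ∧ ND3`,

the weakest honest form (E1 is claimed only where E needs it) and the existential, gap-free shadow of the UV packages the sibling
chains want (10522's `UVPhysics345` / `UVEngine345`: `UUVB ∧ Rot345 ∧ ND2 ∧ ND3` along tuned sequences; 15828's child 2 + child 3).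
Convergence stays free (c2, p160142) and the UV clause stays one-body modulo PTU (c3, p164124).

This file (sorry-free, no definitions):
* `rot345_subScheme` — transport of `Rot345` along sub-schemes;
* `uvScheme345_of_uvBounds345` — the v6 ∃-stub statement implies `UVScheme345` (`…ContinuumLimitExistsDefs`, p149864: the same
  package WITH `ConvProducts`), by the landed compactness extraction `exists_subScheme_convProducts` + `rot345_subScheme`;
* `continuumLimitExists_of_uvScheme345` — the crux BY NAME from `UVScheme345` and the registered ∀-stub statement `stub_coreClustering`
  (so every supplier of `UVScheme345` — e.g. `uvScheme345_of_twoOrbit`, p150943 — plus the IR statement closes E);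
* `continuumLimitExists_of_stubs345` — the v6 composition as a tree theorem: E from the two v6 stub STATEMENTS;
* `uvBounds345_of_arrayExponent`, `continuumLimitExists_of_cbStubs345` — the same with the UV clause in ONE-BODY form (c3's chessboard
  reduction: `UUVB ⇐ PTU + arrays_chessboard + CB`), i.e. the prospective v7 ∃-stub `∃ r sch, weak ∧ PVG ∧ eventually-triadic ∧ CB ∧
  Rot345 ∧ ND2 ∧ ND3` once PTU (15828's `stub_productToUniform`) is a tree theorem.
-/

set_option autoImplicit false

noncomputable section

namespace Summit.QuantumFields.YangMills.Cruxes.ContinuumLimitExists.Birth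

open scoped SchwartzMap
open Filter Topology MeasureTheory
open Literature.MathematicalPhysics.QuantumFieldTheory Literature.MathematicalPhysics.QuantumLattice
  Literature.MathematicalPhysics.AQFT Literature.Probability.LatticeModels
open Summit.QuantumFields.YangMills.Cruxes.ContinuumLimitOnTrajectory.TwoOrbitSynchronisation
open Literature.Barriers.QuantumFields (subScheme hasWeakCouplingLimit_subScheme)
open Summit.QuantumFields.YangMills.Theorems.ContinuumLegGivenGap.AlternatingArrays

section Transport

variable {G : Type} [Group G] [TopologicalSpace G] [IsTopologicalGroup G] [CompactSpace G]
  [MeasurableSpace G] [BorelSpace G]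

/-- `Rot345` rides along every sub-scheme: each clause is a `Tendsto … atTop (𝓝 0)` and the canonical distributions of the
sub-scheme at step `k` are those of the scheme at step `φ k`, definitionally (c3 wave, worker `stub_rotation345`). [folklore] -/
theorem rot345_subScheme {r : LatticeRep G} {sch : SpeciesScheme (YMSpecies G)} (h : Rot345 r sch)
    (φ : ℕ → ℕ) (hφ : StrictMono φ) : Rot345 r (subScheme sch φ hφ) :=
  fun R h0 h1 h2 h3 p F hF => (h R h0 h1 h2 h3 p F hF).comp hφ.tendsto_atTop

/-- **Convergence is free for the 345-package too.** A weak-coupling, polynomially growing Wilson sequence with `UUVB`, `Rot345`,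
`ND2`, `ND3` has a sub-sequence with, in addition, `ConvProducts`, all clauses inherited. [folklore] -/
theorem exists_subScheme_convProducts345 (r : LatticeRep G) (sch : SpeciesScheme (YMSpecies G))
    (hW : sch.HasWeakCouplingLimit) (hGr : PolyVolumeGrowth sch) (hU : UUVB r sch) (h345 : Rot345 r sch)
    (hND2 : ND2 r sch) (hND3 : ND3 r sch) :
    ∃ (ψ : ℕ → ℕ) (hψ : StrictMono ψ),
      (subScheme sch ψ hψ).HasWeakCouplingLimit ∧ PolyVolumeGrowth (subScheme sch ψ hψ) ∧
        ConvProducts r (subScheme sch ψ hψ) ∧ UUVB r (subScheme sch ψ hψ) ∧ Rot345 r (subScheme sch ψ hψ) ∧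
          ND2 r (subScheme sch ψ hψ) ∧ ND3 r (subScheme sch ψ hψ) := by
  obtain ⟨ψ, hψ, h₁, h₂, h₃, h₄, h₅, h₆⟩ := exists_subScheme_convProducts r sch hW hGr hU hND2 hND3
  exact ⟨ψ, hψ, h₁, h₂, h₃, h₄, rot345_subScheme h345 ψ hψ, h₅, h₆⟩

end Transport

/-- **The v6 ∃-stub statement implies `UVScheme345`** (the same package WITH full-sequence convergence on products,
`…ContinuumLimitExistsDefs`): take the sub-scheme of `exists_subScheme_convProducts345`.  Registered glue anchor of
stmt-QuantumFields-16124. [folklore] -/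
theorem uvScheme345_of_uvBounds345 :
    (∀ (G : Type) [Group G] [TopologicalSpace G] [IsTopologicalGroup G] [CompactSpace G]
      [MeasurableSpace G] [BorelSpace G], IsCompactSimpleLieGroup G →
      ∃ (r : LatticeRep G) (sch : SpeciesScheme (YMSpecies G)),
        sch.HasWeakCouplingLimit ∧ PolyVolumeGrowth sch ∧ UUVB r sch ∧ Rot345 r sch ∧ ND2 r sch ∧ ND3 r sch) →
    UVScheme345 := by
  intro h G _ _ _ _ _ _ hG
  obtain ⟨r, sch, hW, hGr, hU, h345, hND2, hND3⟩ := h G hG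
  obtain ⟨ψ, hψ, h₁, h₂, h₃, h₄, h₅, h₆, h₇⟩ := exists_subScheme_convProducts345 r sch hW hGr hU h345 hND2 hND3
  exact ⟨r, subScheme sch ψ hψ, h₁, h₂, h₃, h₄, h₅, h₆, h₇⟩

/-- **The crux BY NAME from `UVScheme345` and the E4 ∀-statement** (`stub_coreClustering` of `Lines/birth.lean`, verbatim): the landed
one-field Osterwalder–Schrader packaging of the sibling line (`oneFieldOSLegs'`), with translations from `stub_transl`, the rotation
half of E1 from `Rot345` by `stub_rotOfPythagorean`, reflection positivity on the odd tori from `β_k → ∞` (`stub_oddTorusRP`, `stub_arp`),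
and E4 from `CoreClustering` by `ucl_of_core`.  Every supplier of `UVScheme345` (e.g. `uvScheme345_of_twoOrbit`, p150943) plus an IR
statement therefore closes E.  Registered glue anchor of stmt-QuantumFields-16124. [folklore] -/
theorem continuumLimitExists_of_uvScheme345 :
    UVScheme345 →
    (∀ (G : Type) [Group G] [TopologicalSpace G] [IsTopologicalGroup G] [CompactSpace G]
      [MeasurableSpace G] [BorelSpace G], IsCompactSimpleLieGroup G →
      ∀ (r : LatticeRep G) (sch : SpeciesScheme (YMSpecies G)),
        sch.HasWeakCouplingLimit → PolyVolumeGrowth sch → ConvProducts r sch → UUVB r sch →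
          CoreClustering r sch) →
    Summit.QuantumFields.YangMills.Theses.OneCertifiedCube.ContinuumLimitExists := by
  intro h₁ h₄ G _ _ _ _ hG
  letI : MeasurableSpace G := borel G
  haveI : BorelSpace G := ⟨rfl⟩
  obtain ⟨r, sch, hW, hGr, hconv, hU, h345, hND2, hND3⟩ := h₁ G hG
  have hUVB : UVB r sch := uvb_of_uuvb r sch hU
  have hRot : AsympRot r sch :=
    Summit.QuantumFields.YangMills.Theorems.ContinuumLegGivenGap.stub_rotOfPythagorean G r sch
      Summit.QuantumFields.YangMills.Theorems.ContinuumLegGivenGap.stub_rotNiven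
      Summit.QuantumFields.YangMills.Theorems.ContinuumLegGivenGap.stub_rotHyper hU h345
  have hE1 : AsympEuclid r sch := (asympEuclid_iff r sch).2 ⟨stub_transl G r sch hGr hU, hRot⟩
  have hARP : ARP r sch := stub_arp G r sch (stub_oddTorusRP G r sch (hW.eventually_ge_atTop 0)) hU hUVB
  have hUCL : UCL r sch := ucl_of_core r sch (stub_axisSymmetry G r sch) hGr hU (h₄ G hG r sch hW hGr hconv hU)
  obtain ⟨T, hYM, hNT, hNG⟩ := oneFieldOSLegs' G r sch hconv hUVB hE1 hARP hUCL hND2 hND3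
  exact ⟨r, canon r sch, T, hW, hYM, hNT, hNG⟩

/-- **The v6 composition of line `birth` as a tree theorem**: the crux BY NAME from the two v6 stub STATEMENTS — the ∃-stub
`stub_uvBounds345` (weak ∧ PVG ∧ UUVB ∧ Rot345 ∧ ND2 ∧ ND3 along ONE Wilson sequence per compact simple `G`) and the E4 ∀-stub
`stub_coreClustering` — through `uvScheme345_of_uvBounds345` and `continuumLimitExists_of_uvScheme345`.  Registered glue anchor of
stmt-QuantumFields-16124 (the `--glue-by` decl if the planner promotes the two stubs to items). [folklore] -/
theorem continuumLimitExists_of_stubs345 :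
    (∀ (G : Type) [Group G] [TopologicalSpace G] [IsTopologicalGroup G] [CompactSpace G]
      [MeasurableSpace G] [BorelSpace G], IsCompactSimpleLieGroup G →
      ∃ (r : LatticeRep G) (sch : SpeciesScheme (YMSpecies G)),
        sch.HasWeakCouplingLimit ∧ PolyVolumeGrowth sch ∧ UUVB r sch ∧ Rot345 r sch ∧ ND2 r sch ∧ ND3 r sch) →
    (∀ (G : Type) [Group G] [TopologicalSpace G] [IsTopologicalGroup G] [CompactSpace G]
      [MeasurableSpace G] [BorelSpace G], IsCompactSimpleLieGroup G →
      ∀ (r : LatticeRep G) (sch : SpeciesScheme (YMSpecies G)),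
        sch.HasWeakCouplingLimit → PolyVolumeGrowth sch → ConvProducts r sch → UUVB r sch →
          CoreClustering r sch) →
    Summit.QuantumFields.YangMills.Theses.OneCertifiedCube.ContinuumLimitExists :=
  fun h₁ h₄ => continuumLimitExists_of_uvScheme345 (uvScheme345_of_uvBounds345 h₁) h₄

/-- **The v6 ∃-stub statement with its UV clause in ONE-BODY form** (prospective v7 ∃-stub `stub_cbBounds345`): given the Whitney
step PTU (`PolyVolumeGrowth → ProductBound → UUVB`, 15828's `stub_productToUniform`, hypothesis), a faithful `r` and a weak-coupling,
polynomially growing, eventually triadic scheme with a `k`-uniform one-body array-exponent bound, the one-rotation clause and the two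
floors give the v6 statement (`uuvb_of_arrayExponent`: chessboard reduction, p164124).  Registered glue anchor of
stmt-QuantumFields-16124. [folklore] -/
theorem uvBounds345_of_arrayExponent :
    (∀ (G : Type) [Group G] [TopologicalSpace G] [IsTopologicalGroup G] [CompactSpace G]
      [MeasurableSpace G] [BorelSpace G] (r : LatticeRep G) (sch : SpeciesScheme (YMSpecies G)),
      PolyVolumeGrowth sch → ProductBound r sch → UUVB r sch) →
    (∀ (G : Type) [Group G] [TopologicalSpace G] [IsTopologicalGroup G] [CompactSpace G]
      [MeasurableSpace G] [BorelSpace G], IsCompactSimpleLieGroup G →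
      ∃ (r : LatticeRep G) (sch : SpeciesScheme (YMSpecies G)),
        sch.HasWeakCouplingLimit ∧ PolyVolumeGrowth sch ∧ (∀ᶠ k in atTop, IsTriadic (sch.L k)) ∧
        (∃ (C : ℝ) (p s k₀ : ℕ), 0 ≤ C ∧
          ∀ k : ℕ, k₀ ≤ k → ∀ (m : ℕ) (v z₀ : Fin 4 → ℤ) (q : PlaqIdx)
            (f : SchwartzMap (EuclideanSpace ℝ (Fin 4)) ℝ),
            LevelAdmissible (sch.L k) m → CellInHalfBox (sch.L k) m v z₀ →
            tsupport f ⊆ physCore (sch.a k) m v z₀ →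
            arrayRoot r (sch.β k) (sch.a k) (sch.L k) m v z₀ q f ≤
              C * max (sch.a k * cellSide m) (sch.a k * cellSide m)⁻¹ ^ p *
                cellNorm s (sch.a k * cellSide m) f) ∧
        Rot345 r sch ∧ ND2 r sch ∧ ND3 r sch) →
    ∀ (G : Type) [Group G] [TopologicalSpace G] [IsTopologicalGroup G] [CompactSpace G]
      [MeasurableSpace G] [BorelSpace G], IsCompactSimpleLieGroup G →
      ∃ (r : LatticeRep G) (sch : SpeciesScheme (YMSpecies G)),
        sch.HasWeakCouplingLimit ∧ PolyVolumeGrowth sch ∧ UUVB r sch ∧ Rot345 r sch ∧ ND2 r sch ∧ ND3 r sch := by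
  intro hPTU hCB G _ _ _ _ _ _ hG
  obtain ⟨r, sch, hW, hGr, hT, ⟨C, p, s, k₀, hC, hCBk⟩, h345, hND2, hND3⟩ := hCB G hG
  exact ⟨r, sch, hW, hGr, uuvb_of_arrayExponent hPTU r sch hW hGr hT hC hCBk, h345, hND2, hND3⟩

/-- **The crux BY NAME from PTU, the one-body 345 ∃-statement and the E4 ∀-statement** — the prospective v7 composition of line
`birth` as a tree theorem (`continuumLimitExists_of_stubs345 ∘ uvBounds345_of_arrayExponent`).  Registered glue anchor of
stmt-QuantumFields-16124. [folklore] -/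
theorem continuumLimitExists_of_cbStubs345 :
    (∀ (G : Type) [Group G] [TopologicalSpace G] [IsTopologicalGroup G] [CompactSpace G]
      [MeasurableSpace G] [BorelSpace G] (r : LatticeRep G) (sch : SpeciesScheme (YMSpecies G)),
      PolyVolumeGrowth sch → ProductBound r sch → UUVB r sch) →
    (∀ (G : Type) [Group G] [TopologicalSpace G] [IsTopologicalGroup G] [CompactSpace G]
      [MeasurableSpace G] [BorelSpace G], IsCompactSimpleLieGroup G →
      ∃ (r : LatticeRep G) (sch : SpeciesScheme (YMSpecies G)),
        sch.HasWeakCouplingLimit ∧ PolyVolumeGrowth sch ∧ (∀ᶠ k in atTop, IsTriadic (sch.L k)) ∧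
        (∃ (C : ℝ) (p s k₀ : ℕ), 0 ≤ C ∧
          ∀ k : ℕ, k₀ ≤ k → ∀ (m : ℕ) (v z₀ : Fin 4 → ℤ) (q : PlaqIdx)
            (f : SchwartzMap (EuclideanSpace ℝ (Fin 4)) ℝ),
            LevelAdmissible (sch.L k) m → CellInHalfBox (sch.L k) m v z₀ →
            tsupport f ⊆ physCore (sch.a k) m v z₀ →
            arrayRoot r (sch.β k) (sch.a k) (sch.L k) m v z₀ q f ≤
              C * max (sch.a k * cellSide m) (sch.a k * cellSide m)⁻¹ ^ p *
                cellNorm s (sch.a k * cellSide m) f) ∧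
        Rot345 r sch ∧ ND2 r sch ∧ ND3 r sch) →
    (∀ (G : Type) [Group G] [TopologicalSpace G] [IsTopologicalGroup G] [CompactSpace G]
      [MeasurableSpace G] [BorelSpace G], IsCompactSimpleLieGroup G →
      ∀ (r : LatticeRep G) (sch : SpeciesScheme (YMSpecies G)),
        sch.HasWeakCouplingLimit → PolyVolumeGrowth sch → ConvProducts r sch → UUVB r sch →
          CoreClustering r sch) →
    Summit.QuantumFields.YangMills.Theses.OneCertifiedCube.ContinuumLimitExists :=
  fun hPTU hCB h₄ => continuumLimitExists_of_stubs345 (uvBounds345_of_arrayExponent hPTU hCB) h₄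

end Summit.QuantumFields.YangMills.Cruxes.ContinuumLimitExists.Birth

end
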